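import Literature.Algebra.Polynomial.LaplacianOrthogonalInvariance
import Mathlib
import HarnessLib

/-!
# Trigonal injectivity — the REGISTERED vocabulary of the sub-skeleton `Lines/trigonal_injectivity.lean`

Crux ⟨stmt-QuantumFields-23035⟩ `ShortRootRigidity`, stub `:146 stub_oddModeRigidity`, algebraic half; sub-skeleton
`Summits/QuantumFields/YangMills/Cruxes/ShortRootRigidity/Lines/trigonal_injectivity.lean` (planner ym-idea-3 g21, commit
b8c4174ce46e; paper proof `Cruxes/ShortRootRigidity/TrigonalInjectivity.md` §1-bis).  Cruxes modules are not importable from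
`Theorems/`, so this file restates the sub-skeleton's DEFINITIONS character-identically (bodies unchanged: `P3`, `lap`, `J3`, `Pm`,
`Rf`, `flipMat`, `OhInvariant`, `TrigonalInjectivityQ`, `alpha`, `betaSq`, `Esect`, `ab`, `abMod`, `Aval`) together with its PROVED
arithmetic anchor (`Aval_ne_one`) and matrix facts, so that the four stubs L1–L4 and the target `TrigonalInjectivityQ s` can be
landed BY NAME + SIGNATURE in `Theorems/` files importing this one.

HONEST LABEL: vocabulary only; `:146`, ⟨23035⟩, ⟨23125⟩ are OPEN; the Yang–Mills mass gap is NOT proved; no summit is proved here.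
-/

noncomputable section

open MvPolynomial
open scoped BigOperators
open Literature.Algebra.Polynomial

namespace Summit.QuantumFields.YangMills.Theorems.F4SubCurvatureDoorTrigonalLineRegistered

/-- real polynomials in three variables -/
abbrev P3 := MvPolynomial (Fin 3) ℝ

/-- polynomial Laplacian on `ℝ[x,y,z]` -/
def lap (Y : P3) : P3 := ∑ i : Fin 3, pderiv i (pderiv i Y)

/-- the all-ones matrix `J` -/
def J3 : Matrix (Fin 3) (Fin 3) ℝ := Matrix.of fun _ _ => 1
/-- projection onto the plane `x+y+z=0` along `(1,1,1)`:  `1 − J/3` -/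
def Pm : Matrix (Fin 3) (Fin 3) ℝ := 1 - (1/3 : ℝ) • J3
/-- reflection in the plane `x+y+z=0`:  `σ = 1 − 2J/3` (orthogonal, rational) -/
def Rf : Matrix (Fin 3) (Fin 3) ℝ := 1 - (2/3 : ℝ) • J3
/-- sign flip of coordinate `i` -/
def flipMat (i : Fin 3) : Matrix (Fin 3) (Fin 3) ℝ := Matrix.diagonal fun j => if j = i then -1 else 1

/-- full octahedral invariance `O_h = S₃ ⋉ {±1}³` -/
def OhInvariant (Y : P3) : Prop :=
  (∀ σ : Equiv.Perm (Fin 3), rename σ Y = Y) ∧ (∀ i : Fin 3, bind₁ (linSubst (flipMat i)) Y = Y)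

/-- THE TARGET (E-free rational Trigonal Injectivity at level `s`). -/
def TrigonalInjectivityQ (s : ℕ) : Prop :=
  ∀ Y : P3, Y.IsHomogeneous (6 * s) → lap Y = 0 → OhInvariant Y → lap (bind₁ (linSubst Pm) Y) = 0 → Y = 0

/-! ## The model sectoral polynomial `E_s = Re λ^{6s}`, `λ = (x−z)/2 + i (x−2y+z)/(2√3)` — rational: only `β² = (x−2y+z)²/12` occurs. -/

/-- `α = (x − z)/2` -/
def alpha : P3 := C (1/2 : ℝ) * (X 0 - X 2)
/-- `β² = (x − 2y + z)²/12` -/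
def betaSq : P3 := C (1/12 : ℝ) * (X 0 - C (2:ℝ) * X 1 + X 2) ^ 2
/-- `E_s(x,y,z) = Σ_k (−1)^k C(6s,2k) α^{6s−2k} (β²)^k = Re (α + iβ)^{6s}` -/
def Esect (s : ℕ) : P3 :=
  ∑ k ∈ Finset.range (3 * s + 1), C ((-1 : ℝ) ^ k * ((6 * s).choose (2 * k) : ℝ)) * alpha ^ (6 * s - 2 * k) * betaSq ^ k

/-! ## Arithmetic anchor (PROVED in the sub-skeleton; = `Cruxes/ShortRootRigidity/TrigonalArithmetic.lean`) -/

/-- integer coordinates of `(2 + √−3)^n = (ab n).1 + (ab n).2 · √−3` -/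
def ab : ℕ → ℤ × ℤ
  | 0 => (1, 0)
  | n + 1 => (2 * (ab n).1 - 3 * (ab n).2, (ab n).1 + 2 * (ab n).2)

/-- the same recursion modulo `7` -/
def abMod : ℕ → ZMod 7 × ZMod 7
  | 0 => (1, 0)
  | n + 1 => (2 * (abMod n).1 - 3 * (abMod n).2, (abMod n).1 + 2 * (abMod n).2)

/-- `abMod` is the reduction of `ab` modulo `7`. -/
theorem abMod_eq_cast (n : ℕ) :
    abMod n = ((((ab n).1 : ℤ) : ZMod 7), (((ab n).2 : ℤ) : ZMod 7)) := by
  induction n with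
  | zero => rfl
  | succ k ih =>
      show (2 * (abMod k).1 - 3 * (abMod k).2, (abMod k).1 + 2 * (abMod k).2)
        = ((((2 * (ab k).1 - 3 * (ab k).2 : ℤ)) : ZMod 7), (((ab k).1 + 2 * (ab k).2 : ℤ) : ZMod 7))
      rw [ih]
      ext <;> push_cast <;> ring

/-- period: `abMod 4 = abMod 1`. -/
theorem abMod_four : abMod 4 = abMod 1 := by decide

/-- `abMod` has period `3` from index `1` on. -/
theorem abMod_periodic (k : ℕ) : abMod (k + 4) = abMod (k + 1) := by
  induction k with
  | zero => exact abMod_four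
  | succ k ih =>
      show (2 * (abMod (k + 4)).1 - 3 * (abMod (k + 4)).2, (abMod (k + 4)).1 + 2 * (abMod (k + 4)).2)
        = (2 * (abMod (k + 1)).1 - 3 * (abMod (k + 1)).2, (abMod (k + 1)).1 + 2 * (abMod (k + 1)).2)
      rw [ih]

/-- `abMod (k + 1 + 3m) = abMod (k + 1)`. -/
theorem abMod_add_three_mul (k m : ℕ) : abMod (k + 1 + 3 * m) = abMod (k + 1) := by
  induction m with
  | zero => simp
  | succ m ih =>
      have h : k + 1 + 3 * (m + 1) = (k + 3 * m) + 4 := by ring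
      rw [h, abMod_periodic, show k + 3 * m + 1 = k + 1 + 3 * m by ring, ih]

/-- `abMod 3 = (4, 2)`. -/
theorem abMod_three : abMod 3 = (4, 2) := by decide

/-- `abMod (6s) = (4, 2)` for `s ≥ 1`. -/
theorem abMod_six_mul (s : ℕ) (hs : 1 ≤ s) : abMod (6 * s) = (4, 2) := by
  obtain ⟨t, rfl⟩ := Nat.exists_eq_add_of_le hs
  have h : 6 * (1 + t) = 2 + 1 + 3 * (2 * t + 1) := by ring
  rw [h, abMod_add_three_mul]
  exact abMod_three

/-- `A_s = Re (2+√−3)^{6s}` as a real number -/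
def Aval (s : ℕ) : ℝ := ((ab (6 * s)).1 : ℝ)

/-- `A_s ≠ 1` (indeed `A_s ≡ 4 (mod 7)`). PROVED. -/
theorem Aval_ne_one (s : ℕ) (hs : 1 ≤ s) : Aval s ≠ 1 := by
  intro h1
  have h1' : (ab (6 * s)).1 = 1 := by
    unfold Aval at h1
    exact_mod_cast h1
  have hmod := abMod_six_mul s hs
  rw [abMod_eq_cast, h1'] at hmod
  have h4 : ((1 : ℤ) : ZMod 7) = 4 := (Prod.mk.inj hmod).1
  revert h4
  decide

/-! ## Matrix-vector facts at the magic point `P = (2,1,3)` (PROVED in the sub-skeleton) -/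

/-- `σ P = (−2,−3,−1)`. -/
theorem Rf_mulVec_P : Rf.mulVec ![2, 1, 3] = ![-2, -3, -1] := by
  ext i; fin_cases i <;> simp [Rf, J3, Matrix.mulVec, dotProduct, Fin.sum_univ_three, Matrix.one_apply] <;> norm_num

/-- `proj P = (0,−1,1)`. -/
theorem Pm_mulVec_P : Pm.mulVec ![2, 1, 3] = ![0, -1, 1] := by
  ext i; fin_cases i <;> simp [Pm, J3, Matrix.mulVec, dotProduct, Fin.sum_univ_three, Matrix.one_apply] <;> norm_num

/-- `proj` is the identity on the plane `x+y+z=0`. -/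
theorem Pm_mulVec_of_plane (p : Fin 3 → ℝ) (hp : p 0 + p 1 + p 2 = 0) : Pm.mulVec p = p := by
  ext i; fin_cases i <;> simp [Pm, J3, Matrix.mulVec, dotProduct, Fin.sum_univ_three, Matrix.one_apply] <;> linarith

/-- the flip of the third coordinate moves `P` into the plane. -/
theorem flip2_mulVec_P : (flipMat 2).mulVec ![2, 1, 3] = ![2, 1, -3] := by
  ext i; fin_cases i <;> simp [flipMat, Matrix.mulVec_diagonal]

/-- the flip of the second coordinate moves `σ P` into the plane. -/
theorem flip1_mulVec_Q : (flipMat 1).mulVec ![-2, -3, -1] = ![-2, 3, -1] := by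
  ext i; fin_cases i <;> simp [flipMat, Matrix.mulVec_diagonal]

/-- value of `Y` at a point `p` of the plane, read through `Y∘proj = a·E_s` -/
theorem eval_plane_of_span {s : ℕ} {Y : P3} {a : ℝ} (ha : bind₁ (linSubst Pm) Y = a • Esect s)
    (p : Fin 3 → ℝ) (hp : p 0 + p 1 + p 2 = 0) : eval p Y = a * eval p (Esect s) := by
  have h := congrArg (eval p) ha
  rw [eval_bind₁_linSubst, Pm_mulVec_of_plane p hp, smul_eval] at h
  exact h

end Summit.QuantumFields.YangMills.Theorems.F4SubCurvatureDoorTrigonalLineRegistered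

end
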